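import Mathlib
import Summits.Ventures.PercRepro.PuncturedLYMUnif33Table

/-!
# PercRepro — (SP) FOR ANY NUMBER OF PAIRWISE DISJOINT `3`-SETS AT LEVEL `3`: THE ROW IDENTITIES (1)
(p10, gen 40)

For each row class: the `3(k − Σ c_v)` new-member directions at `raw … 0`, the `(3 − v) c_v` directions into a member met in
`v` points at `raw … v` (`1 ≤ v ≤ 1`), the `c_2` member columns at `1/3`, and the free directions at `raw … 3` add up to
`#Y / #P = Yc / Pc`, as identities of rational functions in `(n, k)` (`field_simp` with `Qp, Pp, Pc` as atoms, then `ring`).  Nothing here asserts (SP).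
-/

namespace PercRepro.PuncturedLYM.Split.TypeLift.Unif33

/-- The row identity of the class `(0, 0)`. -/
theorem row_00 (n k : ℚ) (hQ : Qp n k ≠ 0) (hP : Pp n k ≠ 0) (hPc : Pc n k ≠ 0) :
    3 * (k - 0) * raw n k 0 0 0 + (n - 3 * k - 3) * raw n k 0 0 3 = Yc n / Pc n k := by
  simp (config := {decide := true}) only [raw, sel, sel_00, if_true, if_false]
  field_simp
  unfold Qp Pp Yc Pc N_00_D0 N_00_F
  ring

/-- The row identity of the class `(1, 0)`. -/
theorem row_10 (n k : ℚ) (hQ : Qp n k ≠ 0) (hP : Pp n k ≠ 0) (hPc : Pc n k ≠ 0) :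
    3 * (k - 1) * raw n k 1 0 0 + 2 * 1 * raw n k 1 0 1 + (n - 3 * k - 2) * raw n k 1 0 3 = Yc n / Pc n k := by
  simp (config := {decide := true}) only [raw, sel, sel_10, if_true, if_false]
  field_simp
  unfold Qp Pp Yc Pc N_10_D0 N_10_D1 N_10_F
  ring

/-- The row identity of the class `(0, 1)`. -/
theorem row_01 (n k : ℚ) (hQ : Qp n k ≠ 0) (hP : Pp n k ≠ 0) (hPc : Pc n k ≠ 0) :
    3 * (k - 1) * raw n k 0 1 0 + 1 / 3 + (n - 3 * k - 1) * raw n k 0 1 3 = Yc n / Pc n k := by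
  simp (config := {decide := true}) only [raw, sel, sel_01, if_true, if_false]
  field_simp
  unfold Qp Pp Yc Pc N_01_D0 N_01_F
  ring

/-- The row identity of the class `(2, 0)`. -/
theorem row_20 (n k : ℚ) (hQ : Qp n k ≠ 0) (hP : Pp n k ≠ 0) (hPc : Pc n k ≠ 0) :
    3 * (k - 2) * raw n k 2 0 0 + 2 * 2 * raw n k 2 0 1 + (n - 3 * k - 1) * raw n k 2 0 3 = Yc n / Pc n k := by
  simp (config := {decide := true}) only [raw, sel, sel_20, if_true, if_false]
  field_simp
  unfold Qp Pp Yc Pc N_20_D0 N_20_D1 N_20_F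
  ring

/-- The row identity of the class `(1, 1)`. -/
theorem row_11 (n k : ℚ) (hQ : Qp n k ≠ 0) (hP : Pp n k ≠ 0) (hPc : Pc n k ≠ 0) :
    3 * (k - 2) * raw n k 1 1 0 + 2 * 1 * raw n k 1 1 1 + 1 / 3 + (n - 3 * k - 0) * raw n k 1 1 3 = Yc n / Pc n k := by
  simp (config := {decide := true}) only [raw, sel, sel_11, if_true, if_false]
  field_simp
  unfold Qp Pp Yc Pc N_11_D0 N_11_D1 N_11_F
  ring

/-- The row identity of the class `(3, 0)`. -/
theorem row_30 (n k : ℚ) (hQ : Qp n k ≠ 0) (hP : Pp n k ≠ 0) (hPc : Pc n k ≠ 0) :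
    3 * (k - 3) * raw n k 3 0 0 + 2 * 3 * raw n k 3 0 1 + (n - 3 * k - 0) * raw n k 3 0 3 = Yc n / Pc n k := by
  simp (config := {decide := true}) only [raw, sel, sel_30, if_true, if_false]
  field_simp
  unfold Qp Pp Yc Pc N_30_D0 N_30_D1 N_30_F
  ring

end PercRepro.PuncturedLYM.Split.TypeLift.Unif33
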